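import Summits.BirchSwinnertonDyer.BirchSwinnertonDyer.Theses.LeadingTerm
import Literature.NumberTheory.EllipticCurves.SelmerCorankControlProofs
import Literature.NumberTheory.EllipticCurves.SelmerCorankHolds
import Literature.NumberTheory.EllipticCurves.ZpCorankQuasiIso

/-!
# BirchSwinnertonDyer / LeadingTerm — crux `PinchPrime` (stmt-BirchSwinnertonDyer-16218),
# line `SketchIdeator2`, stub `stub_leverOrder` (GLUE: the lever, order half)

Registered stub of the lead skeleton `Cruxes/PinchPrime` (line `SketchIdeator2`, card
`first-layer-stability-sharp-pinch`). For an elliptic curve `E/ℚ` (globally minimal `W`), a good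
ordinary prime `p ≥ 5`, the cyclotomic `ℤ_p`-extension datum `κ` with topological generator `γ`,
and an Iwasawa datum `D : W.SelmerDualData κ γ` (the Pontryagin dual
`X = X(E/ℚ_∞) = Hom(Sel_{p^∞}(E/ℚ_∞), ℚ/ℤ)` as an abstract `Λ = ℤ_p⟦T⟧`-module, file
`IwasawaSelmer`) with `X` finitely generated over `Λ`: **if `T · X = 0`, `Ш(E/ℚ)[p^∞]` is finite
and `char_Λ X = (f_E)`, then `ord_{T=0} f_E = rank_ℤ E(ℚ)`** — granted, as a hypothesis, the
control theorem in corank form `rank_{ℤ_p} X/TX = corank_{ℤ_p} Sel_{p^∞}(E/ℚ)` (tree named fact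
`Greenberg1999_coinvariantsRank_eq_selmerCorank_rat`, Greenberg 1999 Thm. 1.2 / Mazur 1972 §6).

Proof (glue over proved tree theorems):

* `T · X = 0` makes `X` a torsion `Λ`-module (`T ∈ Λ` is a non-zero-divisor) and makes
  multiplication by `T` on `V = ℚ_p ⊗_{ℤ_p} X` the zero map (`IwasawaAlgebra.mulTRat p X = 0`), so
  the semisimplicity hypothesis `ker T² = ker T` of the structure-theorem computation holds
  trivially; hence `ord_T f_E = rank_{ℤ_p} X/TX` (`coinvariantsRank`) by the PROVED tree theorem
  `Greenberg1999_order_charGenerator_eq_coinvariantsRank_holds` (Washington §13.2).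
* Control (hypothesis): `rank_{ℤ_p} X/TX = corank_{ℤ_p} Sel_{p^∞}(E/ℚ)` (`W.selmerCorank p`).
* Kummer theory (PROVED, `WeierstrassCurve.selmerCorank_eq_mordellWeilRank_add_holds`,
  Greenberg 1999 §1 pp. 54–57): `corank Sel_{p^∞}(E/ℚ) = rank_ℤ E(ℚ) + corank Ш(E/ℚ)[p^∞]`.
* A finite group has `ℤ_p`-corank `0` (PROVED, `zpCorank_of_finite_eq_zero`).

Sources: R. Greenberg, *Iwasawa theory for elliptic curves*, LNM 1716 (1999), §1 (Thm. 1.2 and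
p. 9 after Conj. 1.12); L. Washington, *Introduction to Cyclotomic Fields*, §13.2 (Thm. 13.12,
Prop. 13.8); B. Mazur, Invent. Math. 18 (1972), §6.
-/

noncomputable section

set_option linter.dupNamespace false

namespace Summit.BirchSwinnertonDyer.BirchSwinnertonDyer.Cruxes.PinchPrime.FirstLayerStability

open scoped MatrixGroups ModularForm
open CongruenceSubgroup Literature.NumberTheory.EllipticCurves
  Literature.NumberTheory.EllipticCurves.ModularForms
open Summit.BirchSwinnertonDyer.BirchSwinnertonDyer.Theses

/-- **Multiplication by `T` on `ℚ_p ⊗_{ℤ_p} M` vanishes when `T · M = 0`.** If `T • x = 0` for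
every `x ∈ M`, then the base change `IwasawaAlgebra.mulTRat p M` of `x ↦ T • x` to
`V = ℚ_p ⊗_{ℤ_p} M` is the zero endomorphism (the underlying `ℤ_p`-linear map
`RestrictScalars.lsmul ℤ_p Λ M T` is already zero, and base change of `0` is `0`). -/
theorem mulTRat_eq_zero_of_X_smul_eq_zero {p : ℕ} [Fact p.Prime] (M : Type*) [AddCommGroup M]
    [Module (IwasawaAlgebra p) M] (hT : ∀ x : M, (PowerSeries.X : IwasawaAlgebra p) • x = 0) :
    IwasawaAlgebra.mulTRat p M = 0 := by
  have hl : RestrictScalars.lsmul ℤ_[p] (IwasawaAlgebra p) M (PowerSeries.X : IwasawaAlgebra p)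
      = 0 := by
    ext x
    simp [RestrictScalars.lsmul_apply_apply, hT]
  unfold IwasawaAlgebra.mulTRat
  rw [hl, LinearMap.baseChange_zero]

/-- **The lever, order half** (stub `stub_leverOrder` of crux `PinchPrime`, line
`SketchIdeator2`). Granted the control theorem in corank form over `ℚ`
(`Greenberg1999_coinvariantsRank_eq_selmerCorank_rat`, a hypothesis): for `E/ℚ` elliptic with
globally minimal model `W`, `p ≥ 5` good ordinary, `κ` the cyclotomic `ℤ_p`-extension with
topological generator `γ`, and a finitely generated Iwasawa datum `D` with `T · X = 0`,
`Ш(E/ℚ)[p^∞]` finite and `char_Λ X = (f_E)`, one has `ord_{T=0} f_E = rank_ℤ E(ℚ)`.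
Chain: `ord_T f_E = rank_{ℤ_p} X/TX` (structure theorem, `T` acts as `0` so `ker T² = ker T`
trivially) `= corank Sel_{p^∞}(E/ℚ)` (control) `= rank + corank Ш[p^∞]` (Kummer) `= rank`
(`Ш[p^∞]` finite). Greenberg (1999), §1, Thm. 1.2 and p. 9; Washington, §13.2. -/
theorem stub_leverOrder :
    Greenberg1999_coinvariantsRank_eq_selmerCorank_rat →
    ∀ (W : WeierstrassCurve ℚ) [W.IsElliptic] [W.IsGloballyMinimal] (p : ℕ) [Fact p.Prime],
      5 ≤ p → IsOrdinaryAt W p →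
      ∀ (κ : ZpExtension ℚ p) (γ : Field.absoluteGaloisGroup ℚ),
        κ.IsCyclotomic → κ.IsTopGenerator γ →
      ∀ (D : W.SelmerDualData κ γ) [Module.Finite (IwasawaAlgebra p) D.X],
        (Ideal.span {(PowerSeries.X : IwasawaAlgebra p)}) • (⊤ : Submodule (IwasawaAlgebra p) D.X)
          = ⊥ →
        Finite (AddCommGroup.primaryComponent W.sha p) →
      ∀ (fE : IwasawaAlgebra p), D.charIdeal = Ideal.span {fE} →
        fE.order = W.mordellWeilRank := by
  intro hcontrol W _ _ p _ _h5 hord κ γ hκ hγ D _ hT hfin fE hfE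
  -- (a) `T` acts as zero on `X`.
  have hT0 : ∀ x : D.X, (PowerSeries.X : IwasawaAlgebra p) • x = 0 := fun x ↦ by
    have h := Submodule.smul_mem_smul
      (Ideal.mem_span_singleton_self (PowerSeries.X : IwasawaAlgebra p))
      (Submodule.mem_top : x ∈ (⊤ : Submodule (IwasawaAlgebra p) D.X))
    rw [hT] at h
    exact (Submodule.mem_bot _).mp h
  -- (b) `X` is a torsion `Λ`-module (`T` is a non-zero-divisor killing it).
  have hX : Module.IsTorsion (IwasawaAlgebra p) D.X := fun x ↦
    ⟨⟨PowerSeries.X, mem_nonZeroDivisors_of_ne_zero PowerSeries.X_ne_zero⟩, hT0 x⟩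
  -- (c) `T = 0` on `ℚ_p ⊗ X`, so `ker T² = ker T` trivially.
  have h0 : IwasawaAlgebra.mulTRat p D.X = 0 := mulTRat_eq_zero_of_X_smul_eq_zero D.X hT0
  have hss : LinearMap.ker (IwasawaAlgebra.mulTRat p D.X ∘ₗ IwasawaAlgebra.mulTRat p D.X)
      = LinearMap.ker (IwasawaAlgebra.mulTRat p D.X) := by
    rw [h0, LinearMap.zero_comp]
  -- (d) Structure theorem: `ord_T f_E = rank_{ℤ_p} X/TX`.
  have h1 : fE.order = (IwasawaAlgebra.coinvariantsRank p D.X : ℕ∞) :=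
    Greenberg1999_order_charGenerator_eq_coinvariantsRank_holds p D.X hX fE hfE hss
  -- (e) Control (hypothesis): `rank_{ℤ_p} X/TX = corank Sel_{p^∞}(E/ℚ)`.
  obtain ⟨-, h2⟩ := hcontrol W p hord.1 hord.2 κ γ hκ hγ D
  -- (f) Kummer theory: `corank Sel_{p^∞}(E/ℚ) = rank + corank Ш[p^∞]`.
  have h3 : W.selmerCorank p = W.mordellWeilRank + W.shaCorank p :=
    W.selmerCorank_eq_mordellWeilRank_add_holds p
  -- (g) `Ш[p^∞]` finite has corank `0`.
  have h4 : W.shaCorank p = 0 := by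
    haveI := hfin
    exact zpCorank_of_finite_eq_zero p
  rw [h1, h2, h3, h4, add_zero]

end Summit.BirchSwinnertonDyer.BirchSwinnertonDyer.Cruxes.PinchPrime.FirstLayerStability

end
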